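import Summits.QuantumAdvantage.QuantumAdvantage.Theorems.CubicForrelationNearExactIsExactKtGapCubic

/-!
# Crux `CubicForrelation.NearExactIsExact` (stmt-QuantumAdvantage-14043) — n = 12: a TYPE-O side is impossible for `Φ ≥ 936/1024`
  (the boundary case `Φ = 936/1024` of `to16_typeO_le_936`: a base set of `896` points at zero excess)

Certificate seat `b2b-cforr-cert` (gen 18).  HONEST FRAMING: a kernel-checked THEOREM (standard axioms, no `decide`/`native_decide`) about
cubic Boolean pairs on 12 bits — the type-O branch of "is `936/1024` attained at `n = 12`?" (tree: `θ₁₂ ∈ [57/64, 937/1024)`).  Finite-slice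
statement; NOT summit progress.

THEOREM `to18_typeO_ge936_false`: cubic `f, g : 𝔽₂¹² → 𝔽₂` with `W_g = 16u`, some `u(x)` odd (type O) and `Φ(f,g) ≥ 936/1024` do not
exist.  Proof.  `to16_typeO_le_936` gives `Φ = 936/1024`, so `Σ τ² = 2¹⁷(1 − Φ) = 11264` (`τ = u − 4(−1)^f`).  Digits: `d₁ = [u/2 odd]`
affine, `d₂ = [u/4 odd]` cubic, `E = {d₁ = d₂}` the support of a cubic, base pattern `τ₀ = (−1)^{d₁}(1 − 4·1_E)`, `τ = τ₀ + 8v`,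
`Σ τ₀² = 4096 + 8#E`, excess `X = τ² − τ₀² ≥ 0`.  Hence `#E ≤ 896`; `#E ≥ 768`, `#E ≠ 768` (gens 12, 15) and the Kasami–Tokura gap
`(768, 896)` (`kt_gap_twelve`, gen 16) force `#E = 896` AND ZERO EXCESS: `v ≡ 0`, `u = 4(−1)^f + τ₀` exactly.  Walsh inversion gives
`4 W_f(y) = 256(−1)^{g(y)} − Σ_x τ₀(x)(−1)^{x·y}`, and with `(−1)^{d₁} = ±(−1)^{c₁·x}` the last sum is `±(4096·[y = c₁] − 4·Σ_{x∈E}(−1)^{x·(c₁⊕y)})`.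
NEW INGREDIENT (`to18_char_sum_E896`): every character sum over a cubic support of `896` points on 12 bits is a multiple of `128`.  Indeed for
`z ≠ 0` the two half weights `#(E ∩ {⟨x,z⟩ = b})` are the weights of CUBICS ON 11 BITS (restriction through the affine chart `ktg_restrict`)
adding up to `896`; a cubic weight on 11 bits that is `≤ 448` lies in `{0, 256, 384, 448}` (minimum weight `256`, nothing in `(256, 384)` by the
second weight, nothing in `(384, 448)` by the Kasami–Tokura gap `kt_gap_cubic_le_sixteen 11`), so both halves are `≡ 0 (mod 64)` and the
character sum `896 − 2·#(E ∩ {⟨x,z⟩ = 1})` is `≡ 0 (mod 128)`.  Therefore `W_f(y) = 64((−1)^{g(y)} + 2M(y))` with `M(y) ∈ ℤ`, every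
`W_f(y)² ≥ 4096`, and Parseval (`Σ_y W_f² = 2²⁴`) forces `W_f(y)² = 4096` for all `y`: the partner `f` is BENT.  By the bent endgame
(`tw_bent_end`: Hou's bound on the dual + Reed–Muller distance) `Φ(g,f) ∈ {1} ∪ (−∞, 7/8]`, contradicting `Φ = 936/1024`.
Consequence: together with `to16_typeO_le_936`, a type-O side has `Φ ≤ 935/1024`; the level-`≥ 6` branch at `936/1024` is treated separately.

References: Ax (1964) / McEliece (1972); Kasami–Tokura (1970) Thm 1; MacWilliams–Sloane (1977) Ch. 13–15; X.-D. Hou (1998); O'Donnell (2014)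
§3.3.  Everything below is proved from Mathlib and the tree; axioms are the standard three.
-/

set_option linter.dupNamespace false -- D-0017: single-problem summit ⇒ `QuantumAdvantage.QuantumAdvantage` by design

noncomputable section

namespace Summit.QuantumAdvantage.QuantumAdvantage.Theorems.CubicForrelation.NearExactIsExact

open Finset
open Literature.Computability.QuantumComplexity
open Literature.Computability.QuantumComplexity.BuzetChailloux (bxor zeroVec bxor_bxor_cancel_left bxor_zeroVec zeroVec_bxor bxor_comm
  bxor_self twist_zeroVec_right twist_bxor_right signOf_sq)
open Literature.Computability.QuantumComplexity.DerivativeWalsh (W sum_W_sq)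
open Summit.QuantumAdvantage.QuantumAdvantage.Theorems.NearExactIsExact.Negative (TypeOTwelve.typeO_of_exists_odd)
open Summit.QuantumAdvantage.QuantumAdvantage.Theorems.SignedCubicForrelationNotPrBPP (knf_isDegLeFun_ip)

/-! ### Cubic weights on 11 bits up to `448`, and character sums over a weight-`896` cubic support on 12 bits -/

/-- **Small cubic weights on 11 bits.**  A Boolean function of degree `≤ 3` on 11 bits has `0`, `256`, `384` or at least `448` ones (minimum
weight `2⁸`, second weight: nothing in `(256, 384)`, Kasami–Tokura gap: nothing in `(384, 448)`). [folklore; cite: KasamiTokura1970 Thm 1] -/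
theorem to18_cubic_weights_eleven (e : (Fin 11 → Bool) → Bool) (he : IsDegLeFun 3 e) :
    #(univ.filter fun y => e y = true) = 0 ∨ #(univ.filter fun y => e y = true) = 256 ∨
    #(univ.filter fun y => e y = true) = 384 ∨ 448 ≤ #(univ.filter fun y => e y = true) := by
  classical
  by_cases hne : ∃ y, e y = true
  · have h1 := bb_rmWeight_holds 11 3 e he hne
    have h3 := kt_gap_cubic_le_sixteen 11 (by norm_num) e he
    by_cases hlt : 16 * #(univ.filter fun y => e y = true) < 3 * 2 ^ 11
    · have h2 := sw_cubic_second_weight (m := 11) e he hne hlt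
      norm_num at h2
      omega
    · norm_num at h1 h3 hlt
      omega
  · left
    push Not at hne
    exact card_eq_zero.2 (filter_eq_empty_iff.2 fun y _ => by simp [hne y])

/-- **Character sums over a weight-896 cubic support are multiples of `128`**: if `c` is cubic on 12 bits with `#{c = 1} = 896` then
`Σ_{x : c(x)=1} (−1)^{x·z} ∈ 128ℤ` for every `z`.  For `z ≠ 0` the sum is `896 − 2·#{c = 1, ⟨x,z⟩ = 1}`, the two parts `#{c = 1, ⟨x,z⟩ = b}`
are weights of cubics on 11 bits (`ktg_restrict`) adding up to `896`, and the smaller one lies in `{0, 256, 384, 448}`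
(`to18_cubic_weights_eleven`), so both are multiples of `64`. [this work] -/
theorem to18_char_sum_E896 (c : (Fin (6 + 6) → Bool) → Bool) (hc : IsDegLeFun 3 c) (h896 : #(univ.filter fun x => c x = true) = 896)
    (z : Fin (6 + 6) → Bool) :
    ∃ m : ℤ, ∑ x ∈ univ.filter (fun x => c x = true), twist x z = 128 * (m : ℝ) := by
  classical
  -- the hyperplane parity `ℓ(x) = ⟨x,z⟩`
  have htw : ∀ x : Fin (6 + 6) → Bool, twist x z =
      1 - 2 * (if decide (Odd #(univ.filter fun i => (x i && z i) = true)) = true then (1 : ℝ) else 0) := by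
    intro x
    rw [vg_twist_eq_signOf x z]
    unfold signOf
    cases decide (Odd #(univ.filter fun i => (x i && z i) = true)) <;> norm_num
  set A := #(univ.filter fun x : Fin (6 + 6) → Bool =>
    c x = true ∧ decide (Odd #(univ.filter fun i => (x i && z i) = true)) = true) with hAdef
  set B := #(univ.filter fun x : Fin (6 + 6) → Bool =>
    c x = true ∧ decide (Odd #(univ.filter fun i => (x i && z i) = true)) = false) with hBdef
  have hsum : ∑ x ∈ univ.filter (fun x => c x = true), twist x z = 896 - 2 * (A : ℝ) := by
    rw [sum_congr rfl fun x _ => htw x, sum_sub_distrib, sum_const, h896, ← mul_sum, sum_boole, filter_filter, ← hAdef]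
    norm_num
  have hAB : A + B = 896 := by
    have h := card_filter_add_card_filter_not (s := univ.filter fun x : Fin (6 + 6) → Bool => c x = true)
      (fun x => decide (Odd #(univ.filter fun i => (x i && z i) = true)) = true)
    rw [filter_filter, filter_filter, h896] at h
    have e : (univ.filter fun x : Fin (6 + 6) → Bool =>
        c x = true ∧ ¬ decide (Odd #(univ.filter fun i => (x i && z i) = true)) = true) =
        univ.filter fun x : Fin (6 + 6) → Bool =>
          c x = true ∧ decide (Odd #(univ.filter fun i => (x i && z i) = true)) = false :=
      filter_congr fun x _ => by simp only [Bool.not_eq_true]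
    rw [e] at h
    exact h
  rw [hsum]
  by_cases hz : ∃ i₀, z i₀ = true
  · obtain ⟨i₀, hi₀⟩ := hz
    -- both halves are weights of cubics on 11 bits
    obtain ⟨cT, hcT, hcardT⟩ := ktg_restrict (k := 11) c hc z i₀ hi₀ true
    obtain ⟨cF, hcF, hcardF⟩ := ktg_restrict (k := 11) c hc z i₀ hi₀ false
    have hA := to18_cubic_weights_eleven cT hcT
    have hB := to18_cubic_weights_eleven cF hcF
    rw [hcardT] at hA
    rw [hcardF] at hB
    change A = 0 ∨ A = 256 ∨ A = 384 ∨ 448 ≤ A at hA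
    change B = 0 ∨ B = 256 ∨ B = 384 ∨ 448 ≤ B at hB
    have hAval : A = 0 ∨ A = 256 ∨ A = 384 ∨ A = 448 ∨ A = 512 ∨ A = 640 ∨ A = 896 := by omega
    rcases hAval with h | h | h | h | h | h | h <;> rw [h]
    · exact ⟨7, by norm_num⟩
    · exact ⟨3, by norm_num⟩
    · exact ⟨1, by norm_num⟩
    · exact ⟨0, by norm_num⟩
    · exact ⟨-1, by norm_num⟩
    · exact ⟨-3, by norm_num⟩
    · exact ⟨-7, by norm_num⟩
  · -- `z = 0`: every parity is even, `A = 0`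
    push Not at hz
    have hA0 : A = 0 := by
      rw [hAdef]
      refine card_eq_zero.2 (filter_eq_empty_iff.2 fun x _ h => ?_)
      have hempty : (univ.filter fun i : Fin (6 + 6) => (x i && z i) = true) = ∅ :=
        filter_eq_empty_iff.2 fun i _ hi => by
          have := hz i
          rw [Bool.and_eq_true] at hi
          rw [hi.2] at this
          exact this rfl
      rw [hempty, card_empty] at h
      simp at h
    rw [hA0]
    exact ⟨7, by norm_num⟩

/-! ### The theorem -/

/-- **A type-O side is impossible for `Φ ≥ 936/1024` on 12 bits.**  Cubic `f, g : 𝔽₂¹² → 𝔽₂` with `W_g = 16u`, some `u(x)` odd and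
`Φ(f,g) ≥ 936/1024` cannot exist (`Φ > 936/1024`: `to16_typeO_le_936`; `Φ = 936/1024`: `#E = 896` at zero excess forces an exact base pattern
whose partner spectrum is `64((−1)^g + 2M)`, hence `f` is bent and `Φ ∈ {1} ∪ (−∞, 7/8]`).  Finite-slice statement; NOT summit progress.
[this work] -/
theorem to18_typeO_ge936_false (f g : (Fin (6 + 6) → Bool) → Bool) (hf : IsDegLeFun 3 f) (hg : IsDegLeFun 3 g)
    (u : (Fin (6 + 6) → Bool) → ℤ) (hu : ∀ x, W (fun y => signOf (g y)) x = (2 : ℝ) ^ 4 * (u x : ℝ))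
    (hodd : ∃ x, Odd (u x)) (hΦ : (936 / 1024 : ℝ) ≤ forrelation f g) : False := by
  classical
  have hΦeq : forrelation f g = 936 / 1024 := le_antisymm (to16_typeO_le_936 f g hf hg u hu hodd) hΦ
  have hall : ∀ x, Odd (u x) := TypeOTwelve.typeO_of_exists_odd g u hg hu hodd
  have hu' : ∀ x, W (fun y => signOf (g y)) x = (2 : ℝ) ^ (2 * 2) * (u x : ℝ) := fun x => (hu x).trans (by norm_num)
  have hd1 : IsDegLeFun 1 (fun x => decide (Odd (u x / 2))) := z2_digitOne 2 g u hg hu' hall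
  have hd2 : IsDegLeFun 3 (fun x => decide (Odd (u x / 2 / 2))) := z2_digitTwo 2 g u hg hu' hall
  set E := univ.filter (fun x : Fin (6 + 6) → Bool => (Odd (u x / 2) ↔ Odd (u x / 2 / 2))) with hEdef
  have hdegE : IsDegLeFun (2 + 1) (fun x => (decide (Odd (u x / 2)) ^^ decide (Odd (u x / 2 / 2))) ^^ true) :=
    tb_isDegLeFun_xor_const (bb_isDegLeFun_bxor (hd1.mono (by norm_num)) hd2) true
  have hsetE : (univ.filter fun x : Fin (6 + 6) → Bool =>
      ((decide (Odd (u x / 2)) ^^ decide (Odd (u x / 2 / 2))) ^^ true) = true) = E := by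
    rw [hEdef]
    apply filter_congr
    intro x _
    by_cases h1 : Odd (u x / 2) <;> by_cases h2 : Odd (u x / 2 / 2) <;> simp [h1, h2]
  have hsumE : (∑ x, (if (Odd (u x / 2) ↔ Odd (u x / 2 / 2)) then 1 else 0 : ℤ)) = #E := by rw [sum_boole]
  -- `#E ≥ 768`, `#E ≠ 768`
  have hE768 : 768 ≤ #E := to15_typeO_E_ge_768 f g hf hg u hu hodd (by rw [hΦeq]; norm_num)
  have hEne : #E ≠ 768 := by
    intro h
    have := to15_typeO_E768_le f g hf hg u hu hodd h
    rw [hΦeq] at this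
    norm_num at this
  -- budget `Σ τ² = 2¹⁷(1 − Φ) = 11264`
  have hbud := tw12_budget f g u hu
  have hT : (∑ x, (u x - 4 * sZ (f x)) ^ 2 : ℤ) = 11264 := by
    have h' : ((∑ x, (u x - 4 * sZ (f x)) ^ 2 : ℤ) : ℝ) = 11264 := by rw [hbud, hΦeq]; norm_num
    exact_mod_cast h'
  -- base pattern `τ₀` and wild function `v`: `τ = τ₀ + 8v`
  choose v hv using fun x => to12_pt_mod8 (u x) (sZ (f x)) (hall x) (tp_sZ_cases (f x))
  set τ₀ : (Fin (6 + 6) → Bool) → ℤ := fun x =>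
    sZ (decide (Odd (u x / 2))) * (1 - 4 * (if (Odd (u x / 2) ↔ Odd (u x / 2 / 2)) then 1 else 0)) with hτ₀def
  have hvx : ∀ x, u x - 4 * sZ (f x) = τ₀ x + 8 * v x := fun x => hv x
  have hτ₀val : ∀ x, τ₀ x = 1 ∨ τ₀ x = -1 ∨ τ₀ x = 3 ∨ τ₀ x = -3 := by
    intro x
    simp only [τ₀]
    rcases tp_sZ_cases (decide (Odd (u x / 2))) with h | h <;> rw [h] <;> split_ifs <;> norm_num
  have hτ₀sq : ∀ x, τ₀ x ^ 2 = 1 + 8 * (if (Odd (u x / 2) ↔ Odd (u x / 2 / 2)) then 1 else 0 : ℤ) := by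
    intro x
    simp only [τ₀]
    rcases tp_sZ_cases (decide (Odd (u x / 2))) with h | h <;> rw [h] <;> split_ifs <;> norm_num
  have hsumτ₀ : ∑ x, τ₀ x ^ 2 = 4096 + 8 * #E := by
    rw [sum_congr rfl fun x _ => hτ₀sq x, sum_add_distrib, ← mul_sum, hsumE, sum_const, card_univ, Fintype.card_fun,
      Fintype.card_bool, Fintype.card_fin]
    norm_num
  -- excess decomposition `Σ τ² = Σ τ₀² + Σ X`, `X ≥ 0`
  set X : (Fin (6 + 6) → Bool) → ℤ := fun x => (τ₀ x + 8 * v x) ^ 2 - τ₀ x ^ 2 with hXdef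
  have hXnn : ∀ x, 0 ≤ X x := fun x => to12_excess_nonneg _ _ (hτ₀val x)
  have hTdec : (∑ x, (u x - 4 * sZ (f x)) ^ 2 : ℤ) = ∑ x, τ₀ x ^ 2 + ∑ x, X x := by
    rw [← sum_add_distrib]
    exact sum_congr rfl fun x _ => by rw [hvx x]; simp only [X]; ring
  have hXsum_nn : 0 ≤ ∑ x, X x := sum_nonneg fun x _ => hXnn x
  have hE896le : #E ≤ 896 := by
    have h1 : (4096 : ℤ) + 8 * #E ≤ 11264 := by linarith
    have h2 : (#E : ℤ) ≤ 896 := by linarith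
    exact_mod_cast h2
  -- the Kasami–Tokura gap: `#E = 896`
  have hE : #E = 896 := by
    by_contra hne
    exact kt_gap_twelve _ hdegE (by rw [hsetE]; omega) (by rw [hsetE]; omega)
  -- zero excess: `τ = τ₀` exactly
  have hXsum0 : ∑ x, X x = 0 := by
    have : (∑ x, (u x - 4 * sZ (f x)) ^ 2 : ℤ) = 11264 + ∑ x, X x := by rw [hTdec, hsumτ₀, hE]; norm_num
    linarith
  have hX0 : ∀ x, X x = 0 := fun x => (sum_eq_zero_iff_of_nonneg fun y _ => hXnn y).1 hXsum0 x (mem_univ x)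
  have hv0 : ∀ x, v x = 0 := by
    intro x
    by_contra hx
    have h1 : 1 ≤ v x ∨ v x ≤ -1 := by omega
    have h2 := to12_excess _ _ 1 (hτ₀val x) le_rfl h1
    have h3 := hX0 x
    simp only [X] at h3
    linarith
  have hτ : ∀ x, ((u x : ℤ) : ℝ) - 4 * (sZ (f x) : ℝ) = (τ₀ x : ℝ) := by
    intro x
    have h := hvx x
    rw [hv0 x, mul_zero, add_zero] at h
    exact_mod_cast h
  -- the affine digit as a character: `(−1)^{d₁} = signOf b₁ · (−1)^{c₁·x}`
  obtain ⟨c₁, b₁, hcb⟩ := stub_affineForm (6 + 6) _ hd1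
  have hsb : signOf b₁ = 1 ∨ signOf b₁ = -1 := by cases b₁ <;> simp [signOf]
  -- the `E`-indicator as the support of the cubic `cE`
  set cE : (Fin (6 + 6) → Bool) → Bool := fun x => (decide (Odd (u x / 2)) ^^ decide (Odd (u x / 2 / 2))) ^^ true with hcEdef
  have hcE3 : IsDegLeFun 3 cE := hdegE
  have hcE896 : #(univ.filter fun x => cE x = true) = 896 := by rw [hsetE, hE]
  have hcEiff : ∀ x, cE x = true ↔ (Odd (u x / 2) ↔ Odd (u x / 2 / 2)) := by
    intro x; simp only [cE]; by_cases h1 : Odd (u x / 2) <;> by_cases h2 : Odd (u x / 2 / 2) <;> simp [h1, h2]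
  -- `τ₀` in real form: `signOf b₁ · twist c₁ x · (1 − 4·[cE x])`
  have hτ₀R : ∀ x, (τ₀ x : ℝ) = signOf b₁ * twist c₁ x * (1 - 4 * (if cE x = true then 1 else 0)) := by
    intro x
    simp only [τ₀]
    push_cast
    rw [tp_sZ_cast, hcb x]
    by_cases h : (Odd (u x / 2) ↔ Odd (u x / 2 / 2))
    · rw [if_pos h, if_pos ((hcEiff x).2 h)]
    · rw [if_neg h, if_neg (fun h' => h ((hcEiff x).1 h'))]
  -- Walsh inversion: `4 W_f(y) = 256 (−1)^{g(y)} − Σ_x τ₀(x) (−1)^{x·y}`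
  have hinvg : ∀ y, ∑ x, (u x : ℝ) * twist x y = 256 * signOf (g y) := by
    intro y
    have h := tz_inversion (fun y => signOf (g y)) y
    rw [sum_congr rfl fun x _ => by rw [hu x]] at h
    have h' : (2 : ℝ) ^ 4 * ∑ x, (u x : ℝ) * twist x y = 2 ^ (6 + 6) * signOf (g y) := by
      rw [mul_sum]; rw [← h]; exact sum_congr rfl fun x _ => by ring
    have e16 : (2 : ℝ) ^ (6 + 6) = 2 ^ 4 * 256 := by norm_num
    rw [e16, mul_assoc] at h'
    exact mul_left_cancel₀ (by positivity) h'
  have h4Wf : ∀ y, 4 * W (fun x => signOf (f x)) y = 256 * signOf (g y) - ∑ x, (τ₀ x : ℝ) * twist x y := by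
    intro y
    unfold W
    rw [mul_sum, ← hinvg y, ← sum_sub_distrib]
    refine sum_congr rfl fun x _ => ?_
    have h := hτ x
    rw [tp_sZ_cast] at h
    have : (4 : ℝ) * signOf (f x) = (u x : ℝ) - (τ₀ x : ℝ) := by linarith
    rw [show (4 : ℝ) * (signOf (f x) * twist x y) = (4 * signOf (f x)) * twist x y by ring, this]; ring
  -- the character sums: `Σ_x τ₀ twist = signOf b₁ (4096·[c₁ ⊕ y = 0] − 4 Σ_{E} twist x (c₁ ⊕ y))`
  have hτ₀sum : ∀ y, ∑ x, (τ₀ x : ℝ) * twist x y =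
      signOf b₁ * ((if bxor c₁ y = (fun _ => false) then (2 : ℝ) ^ (6 + 6) else 0) -
        4 * ∑ x ∈ univ.filter (fun x => cE x = true), twist x (bxor c₁ y)) := by
    intro y
    have e1 : ∀ x, (τ₀ x : ℝ) * twist x y = signOf b₁ * twist x (bxor c₁ y) -
        signOf b₁ * (4 * (if cE x = true then twist x (bxor c₁ y) else 0)) := by
      intro x
      rw [hτ₀R x, twist_bxor_right, twist_comm x c₁]; split_ifs <;> ring
    rw [sum_congr rfl fun x _ => e1 x, sum_sub_distrib, ← mul_sum, ← mul_sum, ← mul_sum, tz_sum_twist_left, ← sum_filter]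
    ring
  -- hence `W_f(y) = 64 ((−1)^{g(y)} + 2 M(y))` with an integer `M(y)`
  have hWf : ∀ y, ∃ M : ℤ, W (fun x => signOf (f x)) y = 64 * (signOf (g y) + 2 * (M : ℝ)) := by
    intro y
    obtain ⟨m, hm⟩ := to18_char_sum_E896 cE hcE3 hcE896 (bxor c₁ y)
    have h := h4Wf y
    rw [hτ₀sum y, hm] at h
    by_cases h0 : bxor c₁ y = (fun _ => false)
    · rw [if_pos h0] at h
      rcases hsb with hs | hs <;> rw [hs] at h
      · exact ⟨m - 8, by push_cast; norm_num at h ⊢; linarith⟩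
      · exact ⟨-(m - 8), by push_cast; norm_num at h ⊢; linarith⟩
    · rw [if_neg h0] at h
      rcases hsb with hs | hs <;> rw [hs] at h
      · exact ⟨m, by norm_num at h ⊢; linarith⟩
      · exact ⟨-m, by push_cast; norm_num at h ⊢; linarith⟩
  choose M hM using hWf
  -- Parseval: `Σ_y W_f(y)² = 2²⁴`, and `W_f(y)² = 4096 (sZ(g y) + 2M)²` with an odd `sZ(g y) + 2M`
  have hPars : ∑ y, W (fun x => signOf (f x)) y ^ 2 = 4096 * 4096 := by
    rw [sum_W_sq, sum_congr rfl fun x _ => signOf_sq (f x), sum_const, card_univ, Fintype.card_fun, Fintype.card_bool,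
      Fintype.card_fin]
    norm_num
  have hsqy : ∀ y, W (fun x => signOf (f x)) y ^ 2 = 4096 * (((sZ (g y) + 2 * M y : ℤ) : ℝ)) ^ 2 := by
    intro y
    rw [hM y, ← tp_sZ_cast]; push_cast; ring
  have hsumsq : ∑ y, ((sZ (g y) + 2 * M y : ℤ) : ℝ) ^ 2 = 4096 := by
    have h := hPars
    rw [sum_congr rfl fun y _ => hsqy y, ← mul_sum] at h
    linarith
  have hsumsqZ : ∑ y, (sZ (g y) + 2 * M y) ^ 2 = (4096 : ℤ) := by exact_mod_cast hsumsq
  have hge1 : ∀ y, 1 ≤ (sZ (g y) + 2 * M y) ^ 2 := by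
    intro y
    have : sZ (g y) + 2 * M y ≤ -1 ∨ 1 ≤ sZ (g y) + 2 * M y := by rcases tp_sZ_cases (g y) with h | h <;> rw [h] <;> omega
    exact tp_sq_ge (k := 1) (by norm_num) this
  have hsq1 : ∀ y, (sZ (g y) + 2 * M y) ^ 2 = 1 := by
    have hz : ∑ y, ((sZ (g y) + 2 * M y) ^ 2 - 1) = (0 : ℤ) := by
      rw [sum_sub_distrib, hsumsqZ, sum_const, card_univ, Fintype.card_fun, Fintype.card_bool, Fintype.card_fin]; norm_num
    intro y
    have h1 := (sum_eq_zero_iff_of_nonneg fun y _ => by linarith [hge1 y]).1 hz y (mem_univ y)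
    linarith
  -- so the partner `f` is bent
  have hbent : ∀ y, W (fun x => signOf (f x)) y ^ 2 = (2 : ℝ) ^ (6 + 6) := by
    intro y
    rw [hsqy y]
    have : (((sZ (g y) + 2 * M y : ℤ) : ℝ)) ^ 2 = 1 := by exact_mod_cast hsq1 y
    rw [this]; norm_num
  -- the bent endgame for the pair `(g, f)`: `Φ = 1` or `Φ ≤ 7/8`
  have hΦ' : forrelation g f = forrelation f g := by
    rw [Summit.QuantumAdvantage.QuantumAdvantage.Theorems.SignedCubicForrelationNotPrBPP.Negative.HalfQuad.forrelation_comm]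
  rcases tw_bent_end (by norm_num) g f hg hf hbent with h | h
  · rw [hΦ', hΦeq] at h; norm_num at h
  · rw [hΦ', hΦeq] at h; norm_num at h

/-- **A type-O side has `Φ ≤ 935/1024`-or-better: `Φ < 936/1024`** (12 bits).  Cubic `f, g` with `W_g = 16u` and some `u(x)` odd:
`Φ(f,g) < 936/1024`.  (The record `57/64 = 912/1024` is attained by a type-O-free pair; no claim that `935/1024` is attained.)
NOT summit progress. [this work] -/
theorem to18_typeO_lt_936 (f g : (Fin (6 + 6) → Bool) → Bool) (hf : IsDegLeFun 3 f) (hg : IsDegLeFun 3 g)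
    (u : (Fin (6 + 6) → Bool) → ℤ) (hu : ∀ x, W (fun y => signOf (g y)) x = (2 : ℝ) ^ 4 * (u x : ℝ))
    (hodd : ∃ x, Odd (u x)) : forrelation f g < 936 / 1024 := by
  by_contra h
  exact to18_typeO_ge936_false f g hf hg u hu hodd (le_of_not_gt h)

end Summit.QuantumAdvantage.QuantumAdvantage.Theorems.CubicForrelation.NearExactIsExact

end
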